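import Summits.NavierStokesRegularity.OSWSelfSimilar.SheetRResolventEvenClass
import Literature.Analysis.OperatorTheory.PseudoResolventRankOneEigenvalue
import HarnessLib

/-!
# SHEET-ℝ frame, EVEN ZERO-MASS class `E⁺₀` — dictionary layer 9: the EVEN EVANS FUNCTION `E⁺(σ) = 1 − θ·ℓ(R⁺_K(σ)f)` and the
# identification «eigenvalue of `T⁺ + θℓ(·)f` ⇔ zero of `E⁺`», «simple zero ⇒ simple eigenvalue» (HYPOTHESIS-LEDGER row (P5)⁺)

HONEST FRAMING (cell ns-blowup GROUP B / zone Z3, case Z3-SR-SPEC EVEN half; HYPOTHESIS-LEDGER v2.1 row (P5)⁺ «identification E⁺*(σ) = 0 ⇔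
eigenvalue; order ⇔ multiplicity — PAPER (no even resolvent dictionary)»; 1-D MODEL certificate frame (viscous gCLM/OSW sheet on the line); not
Euler/NS; «violates: none — MODEL»).  Nothing here asserts that a profile exists or that `E⁺` has any zero; the (S1⁺) datum `GardingDataKE`
is the HYPOTHESIS.  Twin of `SheetREvansOdd` §§1, 3, 4 on the even zero-mass class, stated directly on Kato's closed operator
`T⁺ = generatorEven` (the weak-language translation of `D(T⁺)` is the optional twin of `SheetRGeneratorOddWeak`, not needed by the assembly):

* `evansEven hL K h ℓ f θ σ := 1 − θ·ℓ(resolventEven σ f)` — analytic on `{Re σ > −m}` (`analyticOnNhd_evansEven`), derivative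
  `θ·ℓ(R⁺(σ)R⁺(σ)f)` (`deriv_evansEven`);
* **`exists_eigen_iff_evansEven_eq_zero`** — (P2)⁺: for `Re σ > −m`, `T⁺` has a non-zero `u ∈ D(T⁺)` with `T⁺u = σu − θℓ(u)f` (an eigenvector
  of the rank-one–unlifted operator `T⁺ + θℓ(·)f = −DG⁺|_{E⁺₀}` at `σ`) iff `E⁺(σ) = 0` (`Literature…IsPseudoResolvent.kernel_rankOne_iff_evans`
  + `eigen_rankOne_iff`, injectivity `injective_resolventEven`);
* **`eigen_simple_of_analyticOrderAt_eq_one`** — (P3)⁺, rank one: a zero of order exactly one is a geometrically AND algebraically simple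
  eigenvalue, eigenline spanned by `R⁺_K(σ)f ≠ 0`.
So the even assembly `SheetRSpectrumEvenPointAssembly.eq_half_of_pointDataE` can be INSTANTIATED with `X := WcevenZ hL`, `J := resolventEven hL K h`
(pseudo-resolvent on `{Re ≥ −3/100}` with `‖J(w)g‖ ≤ ‖g‖/(m + Re w)`, `SheetRResolventEvenClass`), `E := evansEven`, and its conclusion read as a
statement about eigenvalues of `−DG⁺(Ω*)|_{E⁺₀}` — the (P5)⁺ identification is no longer paper.  One definition (`evansEven`); no named fact.
WHAT THIS IS NOT: not NS; not the certificate (no zero of `E⁺` is asserted); no number of record moves.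
-/

noncomputable section

namespace Summit.NavierStokesRegularity.OSWSelfSimilar
namespace SheetREvansEven

open _root_.MeasureTheory _root_.Set _root_.Filter _root_.Real SheetREnergySpace SheetREvenTests SheetREvenEnergySpace SheetREvenForms
  SheetREvenResolvent SheetREvenResolventIdentity SheetREvenClass SheetRResolventEvenClass SheetRComplexPivot SheetRResolventIdentity
  Literature.Analysis.OperatorTheory
open scoped Topology ENNReal

variable {L D₀ D₁ V₀ c m : ℝ} {d V : ℝ → ℝ}

/-! ### §1 The Evans function on the even zero-mass class -/

/-- **The even Evans function** of the rank-one perturbation `u ↦ θℓ(u)f` of `T⁺`: `E⁺(σ) = 1 − θ·ℓ(R⁺_K(σ)f)`. [folklore] -/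
def evansEven (hL : 0 < L) (K : EspE L hL →L[ℝ] W L) (h : GardingDataKE L hL d V K D₀ D₁ V₀ c m) (ℓ : WcevenZ hL →L[ℂ] ℂ) (f : WcevenZ hL)
    (θ : ℂ) (σ : ℂ) : ℂ :=
  1 - θ * ℓ (resolventEven hL K h σ f)

/-- Unfolding `evansEven` as a function of `σ`. [folklore] -/
theorem evansEven_eq (hL : 0 < L) (K : EspE L hL →L[ℝ] W L) (h : GardingDataKE L hL d V K D₀ D₁ V₀ c m) (ℓ : WcevenZ hL →L[ℂ] ℂ)
    (f : WcevenZ hL) (θ : ℂ) : evansEven hL K h ℓ f θ = fun σ => 1 - θ * ℓ (resolventEven hL K h σ f) := rfl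

/-- The pointwise form used by the abstract assemblies: `E⁺ w = 1 − θ⟪h, J w f⟫`-shape with `ℓ` in place of `⟪h, ·⟫`. [folklore] -/
theorem evansEven_apply (hL : 0 < L) (K : EspE L hL →L[ℝ] W L) (h : GardingDataKE L hL d V K D₀ D₁ V₀ c m) (ℓ : WcevenZ hL →L[ℂ] ℂ)
    (f : WcevenZ hL) (θ σ : ℂ) : evansEven hL K h ℓ f θ σ = 1 - θ * ℓ (resolventEven hL K h σ f) := rfl

/-- **`E⁺` is analytic on the half-plane `Re σ > −m`.** [folklore] -/
theorem analyticOnNhd_evansEven (hL : 0 < L) (K : EspE L hL →L[ℝ] W L) (h : GardingDataKE L hL d V K D₀ D₁ V₀ c m) (ℓ : WcevenZ hL →L[ℂ] ℂ)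
    (f : WcevenZ hL) (θ : ℂ) : AnalyticOnNhd ℂ (evansEven hL K h ℓ f θ) {σ : ℂ | -m < σ.re} := by
  haveI : CompleteSpace (WcevenZ hL) := completeSpace_WcevenZ hL
  rw [evansEven_eq]
  exact (isPseudoResolvent_resolventEven hL K h).analyticOnNhd_evans (isOpen_halfPlane m) ℓ f θ

/-- **`E⁺′(σ) = θ·ℓ(R⁺_K(σ)R⁺_K(σ)f)`.** [folklore] -/
theorem deriv_evansEven (hL : 0 < L) (K : EspE L hL →L[ℝ] W L) (h : GardingDataKE L hL d V K D₀ D₁ V₀ c m) (ℓ : WcevenZ hL →L[ℂ] ℂ)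
    (f : WcevenZ hL) (θ : ℂ) {σ : ℂ} (hσ : -m < σ.re) :
    deriv (evansEven hL K h ℓ f θ) σ = θ * ℓ (resolventEven hL K h σ (resolventEven hL K h σ f)) := by
  haveI : CompleteSpace (WcevenZ hL) := completeSpace_WcevenZ hL
  rw [evansEven_eq]
  exact (isPseudoResolvent_resolventEven hL K h).deriv_evans (isOpen_halfPlane m) hσ ℓ f θ

/-- **`E⁺` is differentiable (holomorphic) on any subset of the half-plane**, the form `eq_half_of_pointDataE` consumes. [folklore] -/
theorem differentiableOn_evansEven (hL : 0 < L) (K : EspE L hL →L[ℝ] W L) (h : GardingDataKE L hL d V K D₀ D₁ V₀ c m) (ℓ : WcevenZ hL →L[ℂ] ℂ)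
    (f : WcevenZ hL) (θ : ℂ) {S : Set ℂ} (hS : S ⊆ {σ : ℂ | -m < σ.re}) : DifferentiableOn ℂ (evansEven hL K h ℓ f θ) S :=
  ((analyticOnNhd_evansEven hL K h ℓ f θ).mono hS).differentiableOn

/-! ### §2 (P2)⁺: eigenvalue ⇔ zero of the Evans function -/

/-- **(P2)⁺ on the even zero-mass class.**  For `Re σ > −m`: there is a non-zero `u ∈ D(T⁺)` (Kato's closed operator `T⁺ = generatorEven` at the
base point `σ`) with `T⁺u = σu − θℓ(u)f` — i.e. `σ` is an eigenvalue of `T⁺ + θℓ(·)f` — iff `E⁺(σ) = 1 − θℓ(R⁺_K(σ)f) = 0`. [folklore] -/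
theorem exists_eigen_iff_evansEven_eq_zero (hL : 0 < L) (K : EspE L hL →L[ℝ] W L) (h : GardingDataKE L hL d V K D₀ D₁ V₀ c m)
    (ℓ : WcevenZ hL →L[ℂ] ℂ) (f : WcevenZ hL) (θ : ℂ) {σ : ℂ} (hσ : -m < σ.re) :
    (∃ u : WcevenZ hL, u ≠ 0 ∧ ∃ hu : u ∈ (generatorEven hL K h σ hσ).domain,
        generatorEven hL K h σ hσ ⟨u, hu⟩ = σ • u - (θ * ℓ u) • f) ↔ evansEven hL K h ℓ f θ σ = 0 := by
  have hps := isPseudoResolvent_resolventEven hL K h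
  rw [evansEven, ← IsPseudoResolvent.kernel_rankOne_iff_evans (resolventEven hL K h σ) ℓ f θ]
  constructor
  · rintro ⟨u, hu0, hw⟩
    exact ⟨u, hu0, (hps.eigen_rankOne_iff (hinj := injective_resolventEven hL K h hσ) hσ hσ ℓ f θ u).1 hw⟩
  · rintro ⟨u, hu0, hu⟩
    exact ⟨u, hu0, (hps.eigen_rankOne_iff (hinj := injective_resolventEven hL K h hσ) hσ hσ ℓ f θ u).2 hu⟩

/-- **No eigenvalue where `E⁺ ≠ 0`** (contrapositive form used by the census word). [folklore] -/
theorem eq_zero_of_eigen_of_evansEven_ne_zero (hL : 0 < L) (K : EspE L hL →L[ℝ] W L) (h : GardingDataKE L hL d V K D₀ D₁ V₀ c m)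
    (ℓ : WcevenZ hL →L[ℂ] ℂ) (f : WcevenZ hL) (θ : ℂ) {σ : ℂ} (hσ : -m < σ.re) (hE : evansEven hL K h ℓ f θ σ ≠ 0) {u : WcevenZ hL}
    (hu : u ∈ (generatorEven hL K h σ hσ).domain) (hT : generatorEven hL K h σ hσ ⟨u, hu⟩ = σ • u - (θ * ℓ u) • f) : u = 0 := by
  by_contra hu0
  exact hE ((exists_eigen_iff_evansEven_eq_zero hL K h ℓ f θ hσ).1 ⟨u, hu0, hu, hT⟩)

/-! ### §3 (P3)⁺, rank-one case: a simple zero of `E⁺` is a simple eigenvalue -/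

/-- **Simple zero ⇒ simple eigenvalue.**  If `E⁺` vanishes at `σ` (`Re σ > −m`) to order exactly one, then `R⁺_K(σ)f ≠ 0`, the eigenvectors
of `T⁺ + θℓ(·)f` at `σ` are exactly the multiples of `R⁺_K(σ)f`, and there is no generalized eigenvector over a non-zero eigenvector. [folklore] -/
theorem eigen_simple_of_analyticOrderAt_eq_one (hL : 0 < L) (K : EspE L hL →L[ℝ] W L) (h : GardingDataKE L hL d V K D₀ D₁ V₀ c m)
    (ℓ : WcevenZ hL →L[ℂ] ℂ) (f : WcevenZ hL) (θ : ℂ) {σ : ℂ} (hσ : -m < σ.re) (hE1 : analyticOrderAt (evansEven hL K h ℓ f θ) σ = 1) :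
    resolventEven hL K h σ f ≠ 0 ∧
      (∀ u : WcevenZ hL, (∃ hu : u ∈ (generatorEven hL K h σ hσ).domain,
          generatorEven hL K h σ hσ ⟨u, hu⟩ = σ • u - (θ * ℓ u) • f) ↔ ∃ t : ℂ, u = t • resolventEven hL K h σ f) ∧
      ∀ δ₀ : WcevenZ hL, δ₀ ≠ 0 →
        (∃ hu : δ₀ ∈ (generatorEven hL K h σ hσ).domain, generatorEven hL K h σ hσ ⟨δ₀, hu⟩ = σ • δ₀ - (θ * ℓ δ₀) • f) →
        ¬ ∃ δ₁ : WcevenZ hL, ∃ hu : δ₁ ∈ (generatorEven hL K h σ hσ).domain,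
            generatorEven hL K h σ hσ ⟨δ₁, hu⟩ = σ • δ₁ - (θ * ℓ δ₁) • f + δ₀ := by
  haveI : CompleteSpace (WcevenZ hL) := completeSpace_WcevenZ hL
  have hps := isPseudoResolvent_resolventEven hL K h
  rw [evansEven_eq] at hE1
  exact hps.algebraicallySimple_of_analyticOrderAt_eq_one (hinj := injective_resolventEven hL K h hσ) (isOpen_halfPlane m) hσ hσ ℓ f θ hE1

/-! ### §4 The pseudo-resolvent data in the shape the abstract even assembly consumes -/

/-- **The dictionary entry for `SheetRSpectrumEvenPointAssembly`**: with `U := {Re σ > −m}` and `J := resolventEven`, `J` is a pseudo-resolvent on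
`U`, `U` contains the closed half-plane `{Re ≥ r}` for every `r > −m`, and `‖J(w)g‖ ≤ ‖g‖/(m + Re w)` there. [folklore] -/
theorem pseudoResolvent_dataE (hL : 0 < L) (K : EspE L hL →L[ℝ] W L) (h : GardingDataKE L hL d V K D₀ D₁ V₀ c m) {r : ℝ} (hr : -m < r) :
    IsPseudoResolvent {σ : ℂ | -m < σ.re} (resolventEven hL K h) ∧
      (∀ w : ℂ, r ≤ w.re → w ∈ {σ : ℂ | -m < σ.re}) ∧
      ∀ w : ℂ, r ≤ w.re → ∀ g : WcevenZ hL, ‖resolventEven hL K h w g‖ ≤ ‖g‖ / (m + w.re) :=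
  ⟨isPseudoResolvent_resolventEven hL K h, fun _ hw => lt_of_lt_of_le hr hw,
    fun _ hw g => norm_resolventEven_le_inv hL K h (lt_of_lt_of_le hr hw) g⟩

end SheetREvansEven
end Summit.NavierStokesRegularity.OSWSelfSimilar

end
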